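import Literature.NumberTheory.Automorphic.TunnellOctahedralGlobal
import Literature.NumberTheory.Automorphic.AutomorphicRepCentralCharacter
import Literature.NumberTheory.Automorphic.ArthurClozelCuspidalDescentGLOneHolds
import Literature.NumberTheory.Automorphic.AsaiAtOneRankOne
import Literature.NumberTheory.Automorphic.BaseChangeStrongAllFiniteRamifiedPlaces
import Literature.NumberTheory.Automorphic.AutomorphicRepsGLSatakeFlathProofs
import Literature.NumberTheory.Automorphic.GaloisActionPlaces
import Literature.NumberTheory.GaloisRepresentations.HeckeCharacterWeakApproximation
import Literature.NumberTheory.GaloisRepresentations.HeckeLFunctionAnalyticProofs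
import HarnessLib

/-!
# Quadratic descent for `GL₂`, line `Sketch` — stub 1: the central character descends

Helper file for the crux `ParityBlindBianchi.QuadraticDescentGL2` (stmt-Langlands-16811), line
`Sketch`, stub `stub_centralCharacterDescent` (the `GL(1)` part of quadratic descent).

For `E/F` Galois quadratic and a cuspidal `P` on `GL₂(𝔸_E)` whose Satake data are
`Gal(E/F)`-stable almost everywhere, there is a Hecke character `χ` of `F` with
`ω_P = χ⁻¹ ∘ N_{E/F}` on Satake data: `e₂(t_{P,w}) · χ(ϖ_v)^{f(w|v)} = 1` at every `w ∣ v` where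
`P` has a Satake parameter and `χ_v` is unramified.

Proof (all inputs are theorems of the tree):
* the Satake shadow of the central character, `Ω(ϖ_w) = e₂(t_{P,w})` with `Ω` unramified wherever
  `P` is (`AutomorphicRepData.exists_heckeCharacter_valueAtUniformizer_eq_prod`, Borel–Jacquet
  1979 §4.6/5.7);
* Galois-stability of the Satake data a.e. (`IsGaloisStableSatakeAE`) and unramifiedness a.e.
  (`AutomorphicRepData.hasSatakeParamAt_cofinite_holds`, Flath 1979 Thm. 3) give
  `Ω(ϖ_{τ w}) = Ω(ϖ_w)` a.e., i.e. `(Ω ∘ τ)(ϖ_w) = Ω(ϖ_w)` a.e.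
  (`HeckeCharacter.valueAtUniformizer_galConj`), hence `Ω ∘ τ = Ω` by rigidity of Hecke characters
  (`HeckeCharacter.ext_of_eventually_valueAtUniformizer_eq`, Cassels–Fröhlich VII Prop. 4.1);
* a `Gal(E/F)`-invariant Hecke character of `E` is a base change `μ ∘ N_{E/F}` in prime degree
  (`HeckeCharacter.exists_baseChange_eq_of_forall_smul_eq`, Arthur–Clozel Ch. 3 Thm. 4.2 (d) at
  `n = 1`, Cassels–Fröhlich VII Thm. 9.1);
* `(μ ∘ N)(ϖ_w) = μ(ϖ_v)^{f(w|v)}` (`HeckeCharacter.valueAtUniformizer_baseChange`), and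
  `χ := μ⁻¹`.
-/

set_option linter.dupNamespace false

namespace Summit.Langlands.Langlands.Theorems.QuadraticDescentGL2.Sketch

open scoped Classical
open Filter NumberField IsDedekindDomain
open Literature.NumberTheory.Automorphic Literature.NumberTheory.GaloisRepresentations

/-- **The Satake shadow of the central character of a Galois-stable datum is Galois invariant.**
For `E/F` with `Aut(E/F)` acting on places, an automorphic `P` on `GL_n(𝔸_E)` with Galois-stable
Satake data a.e., and a Hecke character `Ω` of `E` with `Ω(ϖ_w) = ∏ α` (and `Ω` unramified at `w`)
whenever `α` is a Satake parameter of `P` at `w`: `Ω (τ • y) = Ω y` for every `τ ∈ Aut(E/F)` and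
every idele `y` (rigidity of Hecke characters from their values at almost all uniformizers,
Cassels–Fröhlich VII Prop. 4.1, applied to `Ω ∘ τ` and `Ω`). [folklore] -/
theorem heckeCharacter_smul_eq_of_isGaloisStableSatakeAE
    {F E : Type} [Field F] [NumberField F] [Field E] [NumberField E] [Algebra F E]
    {n : ℕ} {hE : isCompact_glFiniteIntegralLevel n E}
    {P : AutomorphicRepData (AutomorphyDatum.gl n E hE)} (hst : IsGaloisStableSatakeAE F P)
    {Ω : HeckeCharacter E}
    (hΩ : ∀ (w : HeightOneSpectrum (𝓞 E)) (α : Multiset ℂ),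
      P.HasSatakeParamAt w α → Ω.IsUnramifiedAt w ∧ Ω.valueAtUniformizer w = α.prod)
    (τ : E ≃ₐ[F] E) (y : ideleGroup E) : Ω (τ • y) = Ω y := by
  obtain ⟨Ω', hΩ'⟩ := Ω.exists_galConj τ
  suffices h : Ω' = Ω by rw [← hΩ', h]
  apply HeckeCharacter.ext_of_eventually_valueAtUniformizer_eq
  have hcof : ∀ᶠ w : HeightOneSpectrum (𝓞 E) in cofinite, P.IsUnramifiedAt w :=
    P.hasSatakeParamAt_cofinite_holds
  have hst' : ∀ᶠ w : HeightOneSpectrum (𝓞 E) in cofinite,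
      ∀ w' : HeightOneSpectrum (𝓞 E), w'.asIdeal.under (𝓞 F) = w.asIdeal.under (𝓞 F) →
        ∀ α : Multiset ℂ, P.HasSatakeParamAt w α → P.HasSatakeParamAt w' α := hst
  filter_upwards [hcof, hst'] with w hw hstw
  obtain ⟨α, hα⟩ := hw
  have hunder : (τ • w).asIdeal.under (𝓞 F) = w.asIdeal.under (𝓞 F) :=
    congrArg HeightOneSpectrum.asIdeal (HeightOneSpectrum.under_algEquiv_smul F E τ w)
  have hα' : P.HasSatakeParamAt (τ • w) α := hstw (τ • w) hunder α hα
  rw [HeckeCharacter.valueAtUniformizer_galConj hΩ' (hΩ _ α hα').1, (hΩ _ α hα').2, (hΩ w α hα).2]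

/-- **Stub 1 (central character descent).** For `E/F` Galois with `[E:F] = 2` and a cuspidal `P` on
`GL₂(𝔸_E)` whose Satake data are `Gal(E/F)`-stable a.e., there is a Hecke character `χ` of `F` such that,
for almost every finite place `w` of `E` (over `v` of `F`), every Satake parameter `α` of `P` at `w` satisfies
`e₂(α) · χ(ϖ_v)^{f(w|v)} = 1` whenever `χ` is unramified at `v` — i.e. `ω_P = χ⁻¹ ∘ N_{E/F}`.
(Central character of a Borel–Jacquet datum: Borel–Jacquet 1979 §4.6/5.7, Bump §3.3; GL(1) cyclic descent:
Arthur–Clozel 1989 Ch. 3 Thm 4.2 (d) at `n = 1`, Cassels–Fröhlich VII Thm 9.1.) [folklore] -/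
theorem stub_centralCharacterDescent :
    ∀ (F E : Type) [Field F] [NumberField F] [Field E] [NumberField E] [Algebra F E] [IsGalois F E],
      Module.finrank F E = 2 →
      ∀ (hE : isCompact_glFiniteIntegralLevel 2 E) (P : CuspidalAutomorphicRepData 2 E hE),
        IsGaloisStableSatakeAE F P.1 →
        ∃ χ : HeckeCharacter F,
          ∀ᶠ w : HeightOneSpectrum (𝓞 E) in cofinite, ∀ α : Multiset ℂ,
            P.1.HasSatakeParamAt w α → χ.IsUnramifiedAt (w.under (𝓞 F)) →
              α.prod * χ.valueAtUniformizer (w.under (𝓞 F)) ^ w.asIdeal.inertiaDeg (𝓞 F) = 1 := by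
  intro F E _ _ _ _ _ _ h2 hE P hst
  -- the central character `Ω` of `P` with `Ω(ϖ_w) = ∏ α`
  obtain ⟨Ω, hΩ⟩ := P.1.exists_heckeCharacter_valueAtUniformizer_eq_prod
  -- `Ω` is `Gal(E/F)`-invariant, hence a base change `μ ∘ N_{E/F}`
  have hinv : ∀ (τ : E ≃ₐ[F] E) (y : ideleGroup E), Ω (τ • y) = Ω y :=
    heckeCharacter_smul_eq_of_isGaloisStableSatakeAE hst hΩ
  have hprime : (Module.finrank F E).Prime := by rw [h2]; exact Nat.prime_two
  obtain ⟨μ, hμ⟩ := Ω.exists_baseChange_eq_of_forall_smul_eq hprime hinv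
  -- `χ := μ⁻¹`
  refine ⟨μ⁻¹, Eventually.of_forall fun w α hα hur => ?_⟩
  rw [HeckeCharacter.isUnramifiedAt_inv_iff] at hur
  have hbc : (μ.baseChange E).valueAtUniformizer w =
      μ.valueAtUniformizer (w.under (𝓞 F)) ^ w.asIdeal.inertiaDeg (𝓞 F) :=
    μ.valueAtUniformizer_baseChange hur rfl
  rw [hμ, (hΩ w α hα).2] at hbc
  have hne : μ.valueAtUniformizer (w.under (𝓞 F)) ≠ 0 := Units.ne_zero _
  rw [HeckeCharacter.valueAtUniformizer_inv, hbc, inv_pow, mul_inv_cancel₀ (pow_ne_zero _ hne)]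

end Summit.Langlands.Langlands.Theorems.QuadraticDescentGL2.Sketch
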